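import Mathlib.Analysis.Matrix.Order
import Mathlib.Analysis.CStarAlgebra.Matrix
import Mathlib.Analysis.InnerProductSpace.Basic
import Mathlib.Analysis.Normed.Algebra.MatrixExponential
import Mathlib.Analysis.SpecificLimits.Basic
import HarnessLib

/-!
# Trace inequalities for matrices (Schwarz, Löwner bounds, Lie–Trotter, Golden–Thompson, Bernstein)

Trunk T-QLATTICE (family `hubbard`), topic `MathematicalPhysics/QuantumLattice`: the
finite-dimensional trace toolkit used by Koma–Tasaki (PRL 68 (1992) 3248, proof of eq. (10),
inequalities i)–iv)) to bound thermal expectations `Tr[A e^{-βH}] / Tr[e^{-βH}]` after a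
non-unitary (complex) gauge rotation `H ↦ G H G⁻¹ = H + U + iP`, and more generally by every
Gibbs-state estimate of the quantum-lattice families (`Matrix.gibbsState`, `FinDimSpectrum`).

Proved here (elementary, from Mathlib):

* `norm_trace_mul_le` — the Schwarz inequality for the trace form,
  `|Tr(A B)| ≤ (Tr A⋆A)^{1/2} (Tr B⋆B)^{1/2}` (Koma–Tasaki i)), via Mathlib's Frobenius inner
  product `Matrix.toMatrixInnerProductSpace`;
* `norm_trace_mul_le_of_loewner` — `|Tr(O P)| ≤ c · Tr P` for `-c ≤ O ≤ c` in the Löwner order and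
  `P ≥ 0` (the form in which Koma–Tasaki's ii) `|Tr(O P)| ≤ ‖O‖ Tr P`, `O` Hermitian, `P`
  positive, is used; `‖O‖ = max |eigenvalue|` is exactly the least such `c`);
* `norm_trace_pow_two_pow_succ_le`, `norm_trace_mul_pow_two_pow_le` — Petz (1994) eq. (9)
  `|Tr X^{2k}| ≤ Tr (X X⋆)^k` for `k` a power of two, with its companion
  `|Tr (M N)^k| ≤ (Tr M^{2k})^{1/2} (Tr N^{2k})^{1/2}` (`M, N ≥ 0`), by the simultaneous induction
  of the printed proof of Petz's Theorem 5 (Schwarz + cyclicity `trace_mul_pow_comm`);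
* `trace_conjTranspose_pow_mul_pow_le` — Koma–Tasaki iii): `Tr[(O⋆)^N O^N] ≤ Tr[(O⋆O)^N]`,
  `N = 2^m`, by induction from the companion bound.

Named facts (published results not in Mathlib, stated as `def … : Prop` with their citation,
D-0014; to be discharged bottom-up — the Lie–Trotter formula first, then Petz's Theorem 5 from
eq. (9) and Lie–Trotter as in print, from which Golden–Thompson, Petz's Corollary 6 and
Bernstein's inequality follow):

* `lieTrotter_productFormula` — `(e^{A/s} e^{B/s})^s → e^{A+B}` (Petz 1994 Lemma 4;
  Bernstein 2009 Cor. 11.4.8);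
* `petz_norm_trace_exp_add_le` — Petz (1994) Theorem 5:
  `|Tr e^{A+B}| ≤ Tr e^{(A+A⋆)/2} e^{(B+B⋆)/2}` for arbitrary `A, B` (Bernstein 2009 Fact 11.16.1);
* `goldenThompson` — `Tr e^{A+B} ≤ Tr e^A e^B` for Hermitian `A, B` (Koma–Tasaki iv);
  Petz 1994 eq. (8); Bernstein 2009 Fact 11.16.4);
* `bernstein_trace_exp_mul_exp_conjTranspose_le` — Bernstein's inequality
  `Tr e^K e^{K⋆} ≤ Tr e^{K+K⋆}` (Petz 1994 Theorem 10; Bernstein 2009 Fact 11.15.4), the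
  inequality behind the second step of Koma–Tasaki's (10).

Proved reductions: `petz_of_lieTrotter` (Theorem 5 from the product formula and the finite chain
`norm_trace_mul_pow_two_pow_succ_le`, as in print), `bernstein_of_lieTrotter` (Bernstein's
inequality from iii) and the product formula, Koma–Tasaki's route), `goldenThompson_of_petz`,
`norm_trace_exp_add_I_smul_le_of_petz` (Petz's Corollary 6 `|Tr e^{A+iB}| ≤ Tr e^A`),
`norm_trace_exp_two_smul_le_of_petz`. Hence the single unproved input of this file is the
Lie–Trotter product formula `lieTrotter_productFormula`.

## Sources

* T. Koma, H. Tasaki, PRL **68** (1992) 3248 = arXiv:cond-mat/9709068, proof of eq. (10)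
  (arXiv p. 4): "i) The Schwartz inequality `Tr[OP] ≤ {Tr[O⋆O] Tr[P⋆P]}^{1/2}` with `O, P`
  arbitrary. ii) `|Tr[OP]| ≤ ‖O‖ Tr[P]` with `O` hermitian and `P` positive.
  iii) `Tr[(O⋆)^N O^N] ≤ Tr[(O⋆O)^N]` with `N = 2^m` and `O` arbitrary [14].
  iv) The Golden–Symanzik–Thompson inequality [15] `Tr[e^{O+P}] ≤ Tr[e^O e^P]` where `O, P`
  hermitian."
* D. Petz, *A survey of certain trace inequalities*, Banach Center Publ. **30** (1994) 287–298,
  §3 (held copy): Lemma 4 (exponential product formula), eq. (9), Theorem 5, Corollary 6,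
  eq. (8) (Golden–Thompson), Theorem 10 (Bernstein).
* D. S. Bernstein, *Matrix Mathematics*, 2nd ed. (2009) (held copy): Corollary 11.4.8
  (Lie–Trotter, `𝔽 ∈ {ℝ, ℂ}`), Fact 11.15.4 (Bernstein's inequality), Fact 11.16.1,
  Fact 11.16.4 (Golden–Thompson).

## Design notes

* Scalars: `𝕜` with `[RCLike 𝕜]` (`ℝ` or `ℂ`), which is Bernstein's `𝔽`; Petz states the results
  for complex matrices, of which the real case is a special case. Corollary 6 needs `i` and is
  stated over `ℂ`.
* Traces that are real by construction (`Tr` of a positive matrix, of `e^A e^B` with `A, B`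
  Hermitian, of `e^{K} e^{K⋆}`) are transcribed through `RCLike.re`; absolute values `|Tr ·|`
  through the norm of `𝕜`.
* `exp` is Mathlib's `NormedSpace.exp` on `Matrix n n 𝕜` (topology of the entries; the value is
  norm-independent, cf. `Mathlib.Analysis.Normed.Algebra.MatrixExponential`). The Löwner order
  is Mathlib's scoped `MatrixOrder` (`A ≤ B ↔ (B - A).PosSemidef`).
* In `lieTrotter_productFormula` the sequence is indexed by `s : ℕ`; the term at `s = 0` is the
  junk value `(e^0 e^0)^0 = 1` (`(0 : 𝕜)⁻¹ = 0`), irrelevant along `atTop`.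
* Mathlib search: Mathlib has `NormedSpace.exp`, `Matrix.exp_add_of_commute`,
  `Matrix.IsHermitian.exp`, `Matrix.PosSemidef`, the Frobenius and `L2` operator norms, but no
  Lie–Trotter formula, no Golden–Thompson and no Schatten-norm/majorisation inequalities
  (`rg -i "trotter|golden|thompson|majoriz"` over Mathlib finds nothing relevant).
-/

open Matrix Filter Topology NormedSpace
open scoped ComplexOrder MatrixOrder

namespace Literature.MathematicalPhysics.QuantumLattice

variable {𝕜 : Type*} [RCLike 𝕜] {n : Type*} [Fintype n] [DecidableEq n]

/-! ### i) Schwarz and ii) Löwner bounds (proved) -/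

/-- **Schwarz inequality for the trace form** (Koma–Tasaki i)): for arbitrary square matrices
`|Tr(A B)| ≤ (Tr A⋆A)^{1/2} (Tr B⋆B)^{1/2}`. (Cauchy–Schwarz for the Frobenius/Hilbert–Schmidt
inner product `⟪X, Y⟫ = Tr(Y X⋆)`, Mathlib's `Matrix.toMatrixInnerProductSpace 1`.)
Koma–Tasaki, PRL 68 (1992) 3248, proof of eq. (10), i).
[cite: KomaTasakiPRL1992, proof of eq. (10), inequality i)] -/
theorem norm_trace_mul_le (A B : Matrix n n 𝕜) :
    ‖(A * B).trace‖ ≤ √(RCLike.re (Aᴴ * A).trace) * √(RCLike.re (Bᴴ * B).trace) := by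
  letI : SeminormedAddCommGroup (Matrix n n 𝕜) :=
    (1 : Matrix n n 𝕜).toMatrixSeminormedAddCommGroup PosSemidef.one
  letI : InnerProductSpace 𝕜 (Matrix n n 𝕜) :=
    (1 : Matrix n n 𝕜).toMatrixInnerProductSpace PosSemidef.one
  have h := norm_inner_le_norm (𝕜 := 𝕜) (Bᴴ) A
  have hinner : (inner 𝕜 Bᴴ A : 𝕜) = (A * B).trace := by
    show (A * 1 * Bᴴᴴ).trace = _
    simp
  have hAA : (inner 𝕜 A A : 𝕜) = (Aᴴ * A).trace := by
    show (A * 1 * Aᴴ).trace = _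
    rw [mul_one, trace_mul_comm]
  have hBB : (inner 𝕜 Bᴴ Bᴴ : 𝕜) = (Bᴴ * B).trace := by
    show (Bᴴ * 1 * Bᴴᴴ).trace = _
    rw [mul_one, conjTranspose_conjTranspose]
  have hnA : ‖A‖ = √(RCLike.re (Aᴴ * A).trace) := by
    rw [norm_eq_sqrt_re_inner (𝕜 := 𝕜), hAA]
  have hnB : ‖Bᴴ‖ = √(RCLike.re (Bᴴ * B).trace) := by
    rw [norm_eq_sqrt_re_inner (𝕜 := 𝕜), hBB]
  rw [hinner, hnA, hnB, mul_comm] at h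
  exact h

/-- **Löwner-bounded observables against positive matrices** (the working form of Koma–Tasaki
ii)): if `-c·1 ≤ O ≤ c·1` in the Löwner order and `P` is positive semidefinite, then
`|Tr(O P)| ≤ c · Tr P`. Koma–Tasaki state ii) as `|Tr[O P]| ≤ ‖O‖ Tr[P]` for `O` Hermitian and
`P` positive, `‖O‖` "the maximum of the absolute values of the eigenvalues"; for Hermitian `O`
that norm is the least `c` with `-c ≤ O ≤ c`, so this is the same statement with the spectral
bound made an explicit hypothesis. Proof as in print: write `P = B⋆B`, so
`Tr(O P) = Tr(B O B⋆)` with `-c B B⋆ ≤ B O B⋆ ≤ c B B⋆`, and take traces.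
Koma–Tasaki, PRL 68 (1992) 3248, proof of eq. (10), ii).
[cite: KomaTasakiPRL1992, proof of eq. (10), inequality ii)] -/
theorem norm_trace_mul_le_of_loewner {O P : Matrix n n 𝕜} {c : ℝ}
    (hlo : -(c • (1 : Matrix n n 𝕜)) ≤ O) (hup : O ≤ c • (1 : Matrix n n 𝕜))
    (hP : P.PosSemidef) : ‖(O * P).trace‖ ≤ c * RCLike.re P.trace := by
  obtain ⟨B, rfl⟩ := CStarAlgebra.nonneg_iff_eq_star_mul_self.mp hP.nonneg
  have hcyc : (O * (star B * B)).trace = (B * O * star B).trace := by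
    rw [← Matrix.mul_assoc, trace_mul_comm, Matrix.mul_assoc]
  have hPtr : RCLike.re (star B * B).trace = RCLike.re (B * star B).trace := by
    rw [trace_mul_comm]
  have hup' := star_right_conjugate_le_conjugate hup B
  have hlo' := star_right_conjugate_le_conjugate hlo B
  have htr : ∀ {X Y : Matrix n n 𝕜}, X ≤ Y → RCLike.re X.trace ≤ RCLike.re Y.trace := by
    intro X Y hXY
    have h := (Matrix.le_iff.1 hXY).trace_nonneg
    rw [trace_sub, RCLike.nonneg_iff] at h
    simpa using h.1
  have h1 := htr hup'
  have h2 := htr hlo'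
  have halg : RCLike.re (B * (c • (1 : Matrix n n 𝕜)) * star B).trace =
      c * RCLike.re (B * star B).trace := by
    rw [Matrix.mul_smul, Matrix.mul_one, Matrix.smul_mul, trace_smul]
    simp [RCLike.real_smul_eq_coe_mul]
  rw [halg] at h1
  rw [Matrix.mul_neg, Matrix.neg_mul, trace_neg, map_neg, halg] at h2
  -- `O` is Hermitian, so `Tr(B O B⋆)` is real
  have hOh : Oᴴ = O := by
    have h := (IsSelfAdjoint.of_nonneg (sub_nonneg.2 hup)).star_eq
    simp only [star_sub, star_smul, star_one, star_trivial, sub_right_inj] at h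
    exact h
  have hreal : ((RCLike.re (B * O * star B).trace : ℝ) : 𝕜) = (B * O * star B).trace := by
    refine RCLike.conj_eq_iff_re.1 ?_
    rw [starRingEnd_apply, ← trace_conjTranspose, conjTranspose_mul, conjTranspose_mul, hOh,
      star_eq_conjTranspose, conjTranspose_conjTranspose, Matrix.mul_assoc]
  rw [hcyc, ← hreal, RCLike.norm_ofReal, hPtr, abs_le]
  exact ⟨by linarith, h1⟩

/-! ### iii) and Petz's inequality (9) at powers of two (proved) -/

/-- Cyclicity of the trace under powers: `Tr (A B)^m = Tr (B A)^m`. [folklore] -/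
theorem trace_mul_pow_comm (A B : Matrix n n 𝕜) (m : ℕ) :
    ((A * B) ^ m).trace = ((B * A) ^ m).trace := by
  cases m with
  | zero => simp
  | succ m =>
    rw [pow_succ, ← Matrix.mul_assoc, trace_mul_comm, mul_pow_mul, ← Matrix.mul_assoc,
      ← pow_succ']

omit [DecidableEq n] in
/-- The trace of a positive semidefinite matrix has nonnegative real part. [folklore] -/
theorem re_trace_nonneg_of_posSemidef {P : Matrix n n 𝕜} (hP : P.PosSemidef) :
    0 ≤ RCLike.re P.trace :=
  (RCLike.nonneg_iff.1 hP.trace_nonneg).1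

/-- **Petz (1994), inequality (9), at powers of two**, together with the companion bound used in
its iteration: for every square matrix `X` and every `c`,
`|Tr X^{2^{c+1}}| ≤ Tr (X X⋆)^{2^c}`, and for positive semidefinite `M, N`,
`|Tr (M N)^{2^c}| ≤ (Tr M^{2^{c+1}})^{1/2} (Tr N^{2^{c+1}})^{1/2}`. Both by a simultaneous
induction on `c` from the Schwarz inequality and cyclicity, exactly as in the printed proof of
Petz's Theorem 5 ("by a repeated application of this argument"). Petz, Banach Center Publ. 30
(1994) 287, eq. (9) and proof of Theorem 5. [cite: Petz1994, eq. (9) and proof of Theorem 5] -/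
theorem norm_trace_pow_le_and_norm_trace_mul_pow_le (c : ℕ) :
    (∀ X : Matrix n n 𝕜,
        ‖(X ^ 2 ^ (c + 1)).trace‖ ≤ RCLike.re ((X * Xᴴ) ^ 2 ^ c).trace) ∧
      ∀ M N : Matrix n n 𝕜, M.PosSemidef → N.PosSemidef →
        ‖((M * N) ^ 2 ^ c).trace‖ ≤
          √(RCLike.re (M ^ 2 ^ (c + 1)).trace) * √(RCLike.re (N ^ 2 ^ (c + 1)).trace) := by
  induction c with
  | zero =>
    refine ⟨fun X => ?_, fun M N hM hN => ?_⟩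
    · have h := norm_trace_mul_le X X
      rw [Real.mul_self_sqrt (re_trace_nonneg_of_posSemidef (posSemidef_conjTranspose_mul_self X)),
        trace_mul_comm Xᴴ X] at h
      simpa [pow_two] using h
    · have h := norm_trace_mul_le M N
      rw [hM.1.eq, hN.1.eq] at h
      simpa [pow_two] using h
  | succ c ih =>
    obtain ⟨hT, hS⟩ := ih
    have hpow : ∀ (Y : Matrix n n 𝕜) (k : ℕ), (Y ^ 2) ^ 2 ^ k = Y ^ 2 ^ (k + 1) := by
      intro Y k
      rw [← pow_mul, ← pow_succ']
    refine ⟨fun X => ?_, fun M N hM hN => ?_⟩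
    · have hXX := posSemidef_self_mul_conjTranspose X
      have hXX' := posSemidef_conjTranspose_mul_self X
      have h0 : 0 ≤ RCLike.re ((X * Xᴴ) ^ 2 ^ (c + 1)).trace :=
        re_trace_nonneg_of_posSemidef (hXX.pow _)
      have hcyc : ((X ^ 2 * (X ^ 2)ᴴ) ^ 2 ^ c).trace = ((X * Xᴴ * (Xᴴ * X)) ^ 2 ^ c).trace := by
        rw [conjTranspose_pow, pow_two, pow_two,
          show X * X * (Xᴴ * Xᴴ) = X * (X * Xᴴ * Xᴴ) by simp only [Matrix.mul_assoc],
          trace_mul_pow_comm]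
        simp only [Matrix.mul_assoc]
      calc ‖(X ^ 2 ^ (c + 1 + 1)).trace‖ = ‖((X ^ 2) ^ 2 ^ (c + 1)).trace‖ := by rw [hpow]
        _ ≤ RCLike.re ((X ^ 2 * (X ^ 2)ᴴ) ^ 2 ^ c).trace := hT _
        _ = RCLike.re ((X * Xᴴ * (Xᴴ * X)) ^ 2 ^ c).trace := by rw [hcyc]
        _ ≤ ‖((X * Xᴴ * (Xᴴ * X)) ^ 2 ^ c).trace‖ := RCLike.re_le_norm _
        _ ≤ √(RCLike.re ((X * Xᴴ) ^ 2 ^ (c + 1)).trace) *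
              √(RCLike.re ((Xᴴ * X) ^ 2 ^ (c + 1)).trace) := hS _ _ hXX hXX'
        _ = RCLike.re ((X * Xᴴ) ^ 2 ^ (c + 1)).trace := by
            rw [trace_mul_pow_comm Xᴴ X, Real.mul_self_sqrt h0]
    · have hM2 : (M ^ 2).PosSemidef := hM.pow 2
      have hN2 : (N ^ 2).PosSemidef := hN.pow 2
      have hcyc : ((M * N * (M * N)ᴴ) ^ 2 ^ c).trace = ((N ^ 2 * M ^ 2) ^ 2 ^ c).trace := by
        rw [conjTranspose_mul, hM.1.eq, hN.1.eq,
          show M * N * (N * M) = M * (N * N * M) by simp only [Matrix.mul_assoc],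
          trace_mul_pow_comm, pow_two, pow_two]
        simp only [Matrix.mul_assoc]
      calc ‖((M * N) ^ 2 ^ (c + 1)).trace‖
          ≤ RCLike.re ((M * N * (M * N)ᴴ) ^ 2 ^ c).trace := hT _
        _ = RCLike.re ((N ^ 2 * M ^ 2) ^ 2 ^ c).trace := by rw [hcyc]
        _ ≤ ‖((N ^ 2 * M ^ 2) ^ 2 ^ c).trace‖ := RCLike.re_le_norm _
        _ ≤ √(RCLike.re ((N ^ 2) ^ 2 ^ (c + 1)).trace) *
              √(RCLike.re ((M ^ 2) ^ 2 ^ (c + 1)).trace) := hS _ _ hN2 hM2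
        _ = √(RCLike.re (M ^ 2 ^ (c + 1 + 1)).trace) *
              √(RCLike.re (N ^ 2 ^ (c + 1 + 1)).trace) := by rw [hpow, hpow, mul_comm]

/-- **Petz (1994), inequality (9)** `|Tr X^{2k}| ≤ Tr (X X⋆)^k`, for `k = 2^c` a power of two
(the case used in the printed proof of Theorem 5; the general `k` rests on Weyl's majorant
theorem and is not needed here). Petz, Banach Center Publ. 30 (1994) 287, eq. (9).
[cite: Petz1994, eq. (9)] -/
theorem norm_trace_pow_two_pow_succ_le (X : Matrix n n 𝕜) (c : ℕ) :
    ‖(X ^ 2 ^ (c + 1)).trace‖ ≤ RCLike.re ((X * Xᴴ) ^ 2 ^ c).trace :=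
  (norm_trace_pow_le_and_norm_trace_mul_pow_le c).1 X

/-- The companion bound: for positive semidefinite `M, N` and `k = 2^c`,
`|Tr (M N)^k| ≤ (Tr M^{2k})^{1/2} (Tr N^{2k})^{1/2}`. Petz, Banach Center Publ. 30 (1994) 287,
proof of Theorem 5. [cite: Petz1994, proof of Theorem 5] -/
theorem norm_trace_mul_pow_two_pow_le {M N : Matrix n n 𝕜} (hM : M.PosSemidef)
    (hN : N.PosSemidef) (c : ℕ) :
    ‖((M * N) ^ 2 ^ c).trace‖ ≤
      √(RCLike.re (M ^ 2 ^ (c + 1)).trace) * √(RCLike.re (N ^ 2 ^ (c + 1)).trace) :=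
  (norm_trace_pow_le_and_norm_trace_mul_pow_le c).2 M N hM hN

/-- **Koma–Tasaki iii)**: for an arbitrary square matrix `O` and `N = 2^m`,
`Tr[(O⋆)^N O^N] ≤ Tr[(O⋆ O)^N]` (both traces are real and nonnegative: the left is
`Tr[(O^N)⋆ O^N]`, the right the trace of a power of the positive matrix `O⋆O`; transcribed via
`RCLike.re`). Proved by induction on `m` from the companion bound above and cyclicity
(Koma–Tasaki prove it in their footnote [14] by a similar iteration, "by an argument similar
to that of Golden"). Koma–Tasaki, PRL 68 (1992) 3248, proof of eq. (10), iii), and footnote [14].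
[cite: KomaTasakiPRL1992, proof of eq. (10), inequality iii) and footnote 14] -/
theorem trace_conjTranspose_pow_mul_pow_le (O : Matrix n n 𝕜) (m : ℕ) :
    RCLike.re (Oᴴ ^ 2 ^ m * O ^ 2 ^ m).trace ≤ RCLike.re ((Oᴴ * O) ^ 2 ^ m).trace := by
  induction m generalizing O with
  | zero => simp
  | succ m ih =>
    have hpow : ∀ (Y : Matrix n n 𝕜), (Y ^ 2) ^ 2 ^ m = Y ^ 2 ^ (m + 1) := by
      intro Y
      rw [← pow_mul, ← pow_succ']
    have hOO := posSemidef_conjTranspose_mul_self O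
    have hOO' := posSemidef_self_mul_conjTranspose O
    have h0 : 0 ≤ RCLike.re ((Oᴴ * O) ^ 2 ^ (m + 1)).trace :=
      re_trace_nonneg_of_posSemidef (hOO.pow _)
    have h1 := ih (O ^ 2)
    rw [conjTranspose_pow, hpow, hpow] at h1
    have hcyc : (((Oᴴ) ^ 2 * O ^ 2) ^ 2 ^ m).trace = ((Oᴴ * O * (O * Oᴴ)) ^ 2 ^ m).trace := by
      rw [pow_two, pow_two, show Oᴴ * Oᴴ * (O * O) = Oᴴ * (Oᴴ * O * O) by
        simp only [Matrix.mul_assoc], trace_mul_pow_comm]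
      simp only [Matrix.mul_assoc]
    calc RCLike.re (Oᴴ ^ 2 ^ (m + 1) * O ^ 2 ^ (m + 1)).trace
        ≤ RCLike.re (((Oᴴ) ^ 2 * O ^ 2) ^ 2 ^ m).trace := h1
      _ = RCLike.re ((Oᴴ * O * (O * Oᴴ)) ^ 2 ^ m).trace := by rw [hcyc]
      _ ≤ ‖((Oᴴ * O * (O * Oᴴ)) ^ 2 ^ m).trace‖ := RCLike.re_le_norm _
      _ ≤ √(RCLike.re ((Oᴴ * O) ^ 2 ^ (m + 1)).trace) *
            √(RCLike.re ((O * Oᴴ) ^ 2 ^ (m + 1)).trace) := norm_trace_mul_pow_two_pow_le hOO hOO' m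
      _ = RCLike.re ((Oᴴ * O) ^ 2 ^ (m + 1)).trace := by
          rw [trace_mul_pow_comm O Oᴴ, Real.mul_self_sqrt h0]

/-- **Traces of powers of a product of positive matrices** (the ingredient
`Tr[(A B)^{2^k}] ≤ Tr[A^{2^k} B^{2^k}]` of Koma–Tasaki's footnote [14], for positive semidefinite
`A, B`): `Tr (M N)^{2^j} ≤ Tr (M^{2^j} N^{2^j})` (both traces real; via `RCLike.re`). By
induction on `j` from `norm_trace_pow_two_pow_succ_le` and cyclicity, as in the printed proof
of Petz's Theorem 5. Petz, Banach Center Publ. 30 (1994) 287, proof of Theorem 5;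
Koma–Tasaki, PRL 68 (1992) 3248, footnote [14]. [cite: Petz1994, proof of Theorem 5] -/
theorem re_trace_mul_pow_two_pow_le {M N : Matrix n n 𝕜} (hM : M.PosSemidef)
    (hN : N.PosSemidef) (j : ℕ) :
    RCLike.re ((M * N) ^ 2 ^ j).trace ≤ RCLike.re (M ^ 2 ^ j * N ^ 2 ^ j).trace := by
  induction j generalizing M N with
  | zero => simp
  | succ j ih =>
    have hpow : ∀ (Y : Matrix n n 𝕜), (Y ^ 2) ^ 2 ^ j = Y ^ 2 ^ (j + 1) := by
      intro Y
      rw [← pow_mul, ← pow_succ']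
    have hcyc : ((M * N * (M * N)ᴴ) ^ 2 ^ j).trace = ((M ^ 2 * N ^ 2) ^ 2 ^ j).trace := by
      rw [conjTranspose_mul, hM.1.eq, hN.1.eq,
        show M * N * (N * M) = M * N * N * M by simp only [Matrix.mul_assoc],
        trace_mul_pow_comm, pow_two, pow_two]
      simp only [Matrix.mul_assoc]
    calc RCLike.re ((M * N) ^ 2 ^ (j + 1)).trace
        ≤ ‖((M * N) ^ 2 ^ (j + 1)).trace‖ := RCLike.re_le_norm _
      _ ≤ RCLike.re ((M * N * (M * N)ᴴ) ^ 2 ^ j).trace := norm_trace_pow_two_pow_succ_le _ j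
      _ = RCLike.re ((M ^ 2 * N ^ 2) ^ 2 ^ j).trace := by rw [hcyc]
      _ ≤ RCLike.re ((M ^ 2) ^ 2 ^ j * (N ^ 2) ^ 2 ^ j).trace := ih (hM.pow 2) (hN.pow 2)
      _ = RCLike.re (M ^ 2 ^ (j + 1) * N ^ 2 ^ (j + 1)).trace := by rw [hpow, hpow]

/-- **Petz's finite chain** (proof of Theorem 5): for arbitrary square matrices `A, B` and
`k ≥ 1`, `|Tr (A B)^{2^k}| ≤ Tr ((A⋆A)^{2^{k-1}} (B B⋆)^{2^{k-1}})` — "By a repeated application of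
this argument we easily infer that `Tr((A⋆A)^{2^{k-1}} (BB⋆)^{2^{k-1}}) ≥ |Tr((AB)^{2^k})|`."
Substituting `A ↦ e^{2^{-k}A}`, `B ↦ e^{2^{-k}B}` and letting `k → ∞` with the product formula
gives Theorem 5. Petz, Banach Center Publ. 30 (1994) 287, proof of Theorem 5.
[cite: Petz1994, proof of Theorem 5] -/
theorem norm_trace_mul_pow_two_pow_succ_le (A B : Matrix n n 𝕜) (k : ℕ) :
    ‖((A * B) ^ 2 ^ (k + 1)).trace‖ ≤
      RCLike.re ((Aᴴ * A) ^ 2 ^ k * (B * Bᴴ) ^ 2 ^ k).trace := by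
  have hcyc : ((A * B * (A * B)ᴴ) ^ 2 ^ k).trace = ((Aᴴ * A * (B * Bᴴ)) ^ 2 ^ k).trace := by
    rw [conjTranspose_mul, show A * B * (Bᴴ * Aᴴ) = A * (B * Bᴴ * Aᴴ) by
      simp only [Matrix.mul_assoc], trace_mul_pow_comm,
      show B * Bᴴ * Aᴴ * A = (B * Bᴴ) * (Aᴴ * A) by simp only [Matrix.mul_assoc],
      trace_mul_pow_comm]
  calc ‖((A * B) ^ 2 ^ (k + 1)).trace‖
      ≤ RCLike.re ((A * B * (A * B)ᴴ) ^ 2 ^ k).trace := norm_trace_pow_two_pow_succ_le _ k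
    _ = RCLike.re ((Aᴴ * A * (B * Bᴴ)) ^ 2 ^ k).trace := by rw [hcyc]
    _ ≤ RCLike.re ((Aᴴ * A) ^ 2 ^ k * (B * Bᴴ) ^ 2 ^ k).trace :=
        re_trace_mul_pow_two_pow_le (posSemidef_conjTranspose_mul_self A)
          (posSemidef_self_mul_conjTranspose B) k

/-! ### The exponential product formula and the exponential trace inequalities (named facts) -/

/-- **Lie–Trotter product formula** (Petz 1994, Lemma 4, first equality; Bernstein 2009,
Corollary 11.4.8): for any square matrices `A, B` over `ℝ` or `ℂ`,
`(e^{A/s} e^{B/s})^s → e^{A+B}` as `s → ∞` (`s ∈ ℕ`; Mathlib's `NormedSpace.exp`; the term at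
`s = 0` is a junk value, irrelevant along `atTop`). Petz, Banach Center Publ. 30 (1994) 287,
Lemma 4; Bernstein, *Matrix Mathematics* (2009), Cor. 11.4.8.
[cite: Petz1994, Lemma 4] [cite: Bernstein2009, Corollary 11.4.8] -/
def lieTrotter_productFormula : Prop :=
  ∀ (A B : Matrix n n 𝕜),
    Tendsto (fun s : ℕ => (exp ((s : 𝕜)⁻¹ • A) * exp ((s : 𝕜)⁻¹ • B)) ^ s) atTop
      (𝓝 (exp (A + B)))

/-- **Petz (1994), Theorem 5** (Bernstein 2009, Fact 11.16.1): for ARBITRARY square matrices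
`A, B` over `ℝ` or `ℂ`, `|Tr e^{A+B}| ≤ Tr e^{(A+A⋆)/2} e^{(B+B⋆)/2}` (the right-hand side, the
trace of a product of two positive matrices, is real and nonnegative; transcribed via
`RCLike.re`). Proved in print from inequality (9) and the product formula (Lemma 4).
Petz, Banach Center Publ. 30 (1994) 287, Theorem 5; Bernstein, *Matrix Mathematics* (2009),
Fact 11.16.1. [cite: Petz1994, Theorem 5] [cite: Bernstein2009, Fact 11.16.1] -/
def petz_norm_trace_exp_add_le : Prop :=
  ∀ (A B : Matrix n n 𝕜),
    ‖(exp (A + B)).trace‖ ≤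
      RCLike.re (exp ((2 : 𝕜)⁻¹ • (A + Aᴴ)) * exp ((2 : 𝕜)⁻¹ • (B + Bᴴ))).trace

/-- **Golden–Thompson inequality** (Koma–Tasaki iv); Petz 1994, eq. (8); Bernstein 2009,
Fact 11.16.4): for HERMITIAN square matrices `A, B` over `ℝ` or `ℂ`,
`Tr e^{A+B} ≤ Tr e^A e^B` (both traces are real: `e^{A+B}` is positive and
`Tr e^A e^B = Tr e^{A/2} e^B e^{A/2}`; transcribed via `RCLike.re`).
Petz, Banach Center Publ. 30 (1994) 287, eq. (8); Bernstein, *Matrix Mathematics* (2009),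
Fact 11.16.4; Koma–Tasaki, PRL 68 (1992) 3248, proof of eq. (10), iv), citing their ref. [15]
(their ref. [15]: Golden 1965, Symanzik 1965, Thompson 1965; Lieb–Thirring 1976, App. B).
[cite: Petz1994, eq. (8)]
[cite: Bernstein2009, Fact 11.16.4] [cite: KomaTasakiPRL1992, proof of eq. (10), inequality iv)] -/
def goldenThompson : Prop :=
  ∀ (A B : Matrix n n 𝕜), A.IsHermitian → B.IsHermitian →
    RCLike.re (exp (A + B)).trace ≤ RCLike.re (exp A * exp B).trace

/-- **Bernstein's inequality** (Petz 1994, Theorem 10; Bernstein 2009, Fact 11.15.4): for an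
ARBITRARY square matrix `K` over `ℝ` or `ℂ`, `Tr e^K e^{K⋆} ≤ Tr e^{K+K⋆}` (both traces real and
nonnegative; transcribed via `RCLike.re`; equality iff `K` is normal, not transcribed). This is
the inequality behind the second step of Koma–Tasaki's eq. (10)
(`Tr[e^{-βGHG⁻¹/2} e^{-βG⁻¹HG/2}] ≤ Tr[e^{-β(H+U)}]` with `GHG⁻¹ = H + U + iP`), which they
derive from iii) and the product formula. Petz, Banach Center Publ. 30 (1994) 287, Theorem 10;
Bernstein, *Matrix Mathematics* (2009), Fact 11.15.4.
[cite: Petz1994, Theorem 10] [cite: Bernstein2009, Fact 11.15.4] -/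
def bernstein_trace_exp_mul_exp_conjTranspose_le : Prop :=
  ∀ (K : Matrix n n 𝕜), RCLike.re (exp K * exp Kᴴ).trace ≤ RCLike.re (exp (K + Kᴴ)).trace

/-! ### Reductions among the exponential inequalities (proved) -/

omit [Fintype n] [DecidableEq n] in
/-- For Hermitian `A`, `(A + A⋆)/2 = A`. [folklore] -/
theorem inv_two_smul_add_conjTranspose_of_isHermitian {A : Matrix n n 𝕜} (hA : A.IsHermitian) :
    (2 : 𝕜)⁻¹ • (A + Aᴴ) = A := by
  rw [hA.eq, ← two_smul 𝕜 A, smul_smul, inv_mul_cancel₀ two_ne_zero, one_smul]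

/-- **Golden–Thompson from Petz's Theorem 5**: for Hermitian `A, B` one has `(A + A⋆)/2 = A`,
`(B + B⋆)/2 = B` and `Tr e^{A+B} ≤ |Tr e^{A+B}|`, so Theorem 5 specialises to eq. (8).
Petz, Banach Center Publ. 30 (1994) 287, sentence after the proof of Theorem 5 ("Inequality (8)
is an obvious consequence of the theorem"). [cite: Petz1994, Theorem 5 and eq. (8)] -/
theorem goldenThompson_of_petz (h : petz_norm_trace_exp_add_le (𝕜 := 𝕜) (n := n)) :
    goldenThompson (𝕜 := 𝕜) (n := n) := by
  intro A B hA hB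
  have h' := h A B
  rw [inv_two_smul_add_conjTranspose_of_isHermitian hA,
    inv_two_smul_add_conjTranspose_of_isHermitian hB] at h'
  exact (RCLike.re_le_norm _).trans h'

/-- **Petz (1994), Corollary 6, from Theorem 5**: for Hermitian complex matrices `A, B`,
`|Tr e^{A+iB}| ≤ Tr e^A` (apply Theorem 5 to the pair `(A + iB, 0)`: `(A + iB + (A + iB)⋆)/2 = A`
and `e^0 = 1`). Petz, Banach Center Publ. 30 (1994) 287, Corollary 6.
[cite: Petz1994, Corollary 6] -/
theorem norm_trace_exp_add_I_smul_le_of_petz {m : Type*} [Fintype m] [DecidableEq m]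
    (h : petz_norm_trace_exp_add_le (𝕜 := ℂ) (n := m)) (A B : Matrix m m ℂ)
    (hA : A.IsHermitian) (hB : B.IsHermitian) :
    ‖(exp (A + Complex.I • B)).trace‖ ≤ (exp A).trace.re := by
  have h' := h (A + Complex.I • B) 0
  have hre : (2 : ℂ)⁻¹ • (A + Complex.I • B + (A + Complex.I • B)ᴴ) = A := by
    rw [conjTranspose_add, conjTranspose_smul, hA.eq, hB.eq, Complex.star_def, Complex.conj_I,
      neg_smul, add_add_add_comm, add_neg_cancel, add_zero, ← two_smul ℂ A, smul_smul,
      inv_mul_cancel₀ two_ne_zero, one_smul]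
  rw [add_zero, hre, conjTranspose_zero, add_zero, smul_zero, exp_zero, mul_one] at h'
  exact h'

/-- **Bernstein's inequality from Petz's Theorem 5** in the weak form
`|Tr e^{2K}| ≤ Tr e^{(K+K⋆)/2} e^{(K+K⋆)/2}` (Theorem 5 with `A = B = K`); recorded as the first
link of the chain of Bernstein 2009, Fact 11.15.4 (`|Tr e^{2A}| ≤ Tr e^A e^{A⋆} ≤ Tr e^{A+A⋆}`),
whose middle inequality is `bernstein_trace_exp_mul_exp_conjTranspose_le`.
Bernstein, *Matrix Mathematics* (2009), Fact 11.15.4; Petz (1994), Theorem 5.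
[cite: Bernstein2009, Fact 11.15.4] [cite: Petz1994, Theorem 5] -/
theorem norm_trace_exp_two_smul_le_of_petz (h : petz_norm_trace_exp_add_le (𝕜 := 𝕜) (n := n))
    (K : Matrix n n 𝕜) :
    ‖(exp ((2 : 𝕜) • K)).trace‖ ≤
      RCLike.re (exp ((2 : 𝕜)⁻¹ • (K + Kᴴ)) * exp ((2 : 𝕜)⁻¹ • (K + Kᴴ))).trace := by
  simpa [two_smul] using h K K

/-! ### Everything from the Lie–Trotter formula (proved reductions) -/

/-- Scalar bookkeeping for the dyadic subsequences: `(2^{k+1})⁻¹ = (2^k)⁻¹ · 2⁻¹` in `𝕜`. [folklore] -/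
theorem inv_natCast_two_pow_succ (k : ℕ) :
    (((2 ^ (k + 1) : ℕ) : 𝕜))⁻¹ = (((2 ^ k : ℕ) : 𝕜))⁻¹ * (2 : 𝕜)⁻¹ := by
  push_cast; rw [pow_succ, mul_inv]

/-- **Petz's Theorem 5 from the Lie–Trotter formula** (the printed proof): substitute
`A ↦ e^{2^{-(k+1)}A}`, `B ↦ e^{2^{-(k+1)}B}` in the finite chain
`norm_trace_mul_pow_two_pow_succ_le`; the left-hand side is `|Tr (e^{A/N} e^{B/N})^N|`,
`N = 2^{k+1}`, which tends to `|Tr e^{A+B}|`, and the right-hand side is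
`Tr (e^{A⋆/N} e^{A/N})^{N/2} (e^{B/N} e^{B⋆/N})^{N/2} → Tr e^{(A⋆+A)/2} e^{(B+B⋆)/2}`, three
instances of the product formula along the subsequence `s = 2^k` ("The obvious continuity of Tr
together with the exponential product formula (that is, Lemma 4) allows us to obtain the
theorem"). Petz, Banach Center Publ. 30 (1994) 287, proof of Theorem 5.
[cite: Petz1994, proof of Theorem 5] -/
theorem petz_of_lieTrotter (h : lieTrotter_productFormula (𝕜 := 𝕜) (n := n)) :
    petz_norm_trace_exp_add_le (𝕜 := 𝕜) (n := n) := by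
  intro A B
  have h2 : Tendsto (fun k : ℕ => 2 ^ k) atTop atTop :=
    tendsto_pow_atTop_atTop_of_one_lt one_lt_two
  have h2' : Tendsto (fun k : ℕ => 2 ^ (k + 1)) atTop atTop :=
    h2.comp (tendsto_add_atTop_nat 1)
  -- the three matrix sequences
  set X : ℕ → Matrix n n 𝕜 := fun k => exp ((((2 ^ (k + 1) : ℕ) : 𝕜))⁻¹ • A) with hX
  set Y : ℕ → Matrix n n 𝕜 := fun k => exp ((((2 ^ (k + 1) : ℕ) : 𝕜))⁻¹ • B) with hY
  have hstar : ∀ k : ℕ, star ((((2 ^ (k + 1) : ℕ) : 𝕜))⁻¹) = (((2 ^ (k + 1) : ℕ) : 𝕜))⁻¹ := by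
    intro k; rw [star_inv₀, star_natCast]
  have hXc : ∀ k, (X k)ᴴ = exp ((((2 ^ k : ℕ) : 𝕜))⁻¹ • ((2 : 𝕜)⁻¹ • Aᴴ)) := by
    intro k
    rw [hX]
    dsimp only
    rw [← exp_conjTranspose, conjTranspose_smul, hstar, inv_natCast_two_pow_succ, mul_smul]
  have hXe : ∀ k, X k = exp ((((2 ^ k : ℕ) : 𝕜))⁻¹ • ((2 : 𝕜)⁻¹ • A)) := by
    intro k; rw [hX]; dsimp only; rw [inv_natCast_two_pow_succ, mul_smul]
  have hYc : ∀ k, (Y k)ᴴ = exp ((((2 ^ k : ℕ) : 𝕜))⁻¹ • ((2 : 𝕜)⁻¹ • Bᴴ)) := by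
    intro k
    rw [hY]
    dsimp only
    rw [← exp_conjTranspose, conjTranspose_smul, hstar, inv_natCast_two_pow_succ, mul_smul]
  have hYe : ∀ k, Y k = exp ((((2 ^ k : ℕ) : 𝕜))⁻¹ • ((2 : 𝕜)⁻¹ • B)) := by
    intro k; rw [hY]; dsimp only; rw [inv_natCast_two_pow_succ, mul_smul]
  -- (1) `(X_k Y_k)^{2^{k+1}} → e^{A+B}`
  have hL : Tendsto (fun k => (X k * Y k) ^ 2 ^ (k + 1)) atTop (𝓝 (exp (A + B))) :=
    (h A B).comp h2'
  -- (2) `(X_kᴴ X_k)^{2^k} → e^{(A+Aᴴ)/2}`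
  have hM : Tendsto (fun k => ((X k)ᴴ * X k) ^ 2 ^ k) atTop
      (𝓝 (exp ((2 : 𝕜)⁻¹ • (A + Aᴴ)))) := by
    have := (h ((2 : 𝕜)⁻¹ • Aᴴ) ((2 : 𝕜)⁻¹ • A)).comp h2
    rw [← smul_add, add_comm] at this
    refine this.congr fun k => ?_
    rw [Function.comp_apply, hXc, hXe]
  -- (3) `(Y_k Y_kᴴ)^{2^k} → e^{(B+Bᴴ)/2}`
  have hN : Tendsto (fun k => (Y k * (Y k)ᴴ) ^ 2 ^ k) atTop
      (𝓝 (exp ((2 : 𝕜)⁻¹ • (B + Bᴴ)))) := by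
    have := (h ((2 : 𝕜)⁻¹ • B) ((2 : 𝕜)⁻¹ • Bᴴ)).comp h2
    rw [← smul_add] at this
    refine this.congr fun k => ?_
    rw [Function.comp_apply, hYc, hYe]
  -- traces
  have htr : Continuous fun M : Matrix n n 𝕜 => M.trace := continuous_id.matrix_trace
  have hlhs : Tendsto (fun k => ‖((X k * Y k) ^ 2 ^ (k + 1)).trace‖) atTop
      (𝓝 ‖(exp (A + B)).trace‖) := ((htr.tendsto _).comp hL).norm
  have hrhs : Tendsto (fun k => RCLike.re (((X k)ᴴ * X k) ^ 2 ^ k * (Y k * (Y k)ᴴ) ^ 2 ^ k).trace)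
      atTop (𝓝 (RCLike.re (exp ((2 : 𝕜)⁻¹ • (A + Aᴴ)) * exp ((2 : 𝕜)⁻¹ • (B + Bᴴ))).trace)) :=
    (RCLike.continuous_re.tendsto _).comp ((htr.tendsto _).comp (hM.mul hN))
  exact le_of_tendsto_of_tendsto' hlhs hrhs fun k => norm_trace_mul_pow_two_pow_succ_le _ _ k

/-- **Bernstein's inequality from the Lie–Trotter formula**, along the route of Koma–Tasaki's
second step in eq. (10): with `X = e^{K/N}`, `N = 2^m`, inequality iii) reads
`Tr[e^{K⋆} e^{K}] = Tr[(X⋆)^N X^N] ≤ Tr[(X⋆X)^N] = Tr (e^{K⋆/N} e^{K/N})^N`, and the right-hand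
side "converges to `Tr[exp[K⋆ + K]]` as `N → ∞`" by the product formula.
Koma–Tasaki, PRL 68 (1992) 3248, proof of eq. (10) (the bound via `X = exp[-βGHG⁻¹/2N]`);
Petz (1994), Theorem 10; Bernstein (2009), Fact 11.15.4.
[cite: KomaTasakiPRL1992, proof of eq. (10), second bound] [cite: Petz1994, Theorem 10] -/
theorem bernstein_of_lieTrotter (h : lieTrotter_productFormula (𝕜 := 𝕜) (n := n)) :
    bernstein_trace_exp_mul_exp_conjTranspose_le (𝕜 := 𝕜) (n := n) := by
  intro K
  have h2 : Tendsto (fun m : ℕ => 2 ^ m) atTop atTop :=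
    tendsto_pow_atTop_atTop_of_one_lt one_lt_two
  set X : ℕ → Matrix n n 𝕜 := fun m => exp ((((2 ^ m : ℕ) : 𝕜))⁻¹ • K) with hX
  have hstar : ∀ m : ℕ, star ((((2 ^ m : ℕ) : 𝕜))⁻¹) = (((2 ^ m : ℕ) : 𝕜))⁻¹ := by
    intro m; rw [star_inv₀, star_natCast]
  have hXc : ∀ m, (X m)ᴴ = exp ((((2 ^ m : ℕ) : 𝕜))⁻¹ • Kᴴ) := by
    intro m; rw [hX]; dsimp only; rw [← exp_conjTranspose, conjTranspose_smul, hstar]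
  have hXpow : ∀ m, X m ^ 2 ^ m = exp K := by
    intro m
    rw [hX]
    dsimp only
    rw [← Matrix.exp_nsmul, ← Nat.cast_smul_eq_nsmul 𝕜, smul_smul,
      mul_inv_cancel₀ (Nat.cast_ne_zero.2 (pow_ne_zero _ two_ne_zero)), one_smul]
  have hXcpow : ∀ m, (X m)ᴴ ^ 2 ^ m = exp Kᴴ := by
    intro m; rw [← conjTranspose_pow, hXpow, exp_conjTranspose]
  -- KT iii) at level `m`: `Tr[e^{Kᴴ} e^{K}] ≤ Tr[(X_mᴴ X_m)^{2^m}]`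
  have hineq : ∀ m, RCLike.re (exp Kᴴ * exp K).trace ≤ RCLike.re (((X m)ᴴ * X m) ^ 2 ^ m).trace := by
    intro m
    have := trace_conjTranspose_pow_mul_pow_le (X m) m
    rwa [hXpow, hXcpow] at this
  -- the right-hand side tends to `Tr e^{Kᴴ + K}`
  have hlim : Tendsto (fun m => RCLike.re (((X m)ᴴ * X m) ^ 2 ^ m).trace) atTop
      (𝓝 (RCLike.re (exp (Kᴴ + K)).trace)) := by
    have := (h Kᴴ K).comp h2
    have hmat : Tendsto (fun m => ((X m)ᴴ * X m) ^ 2 ^ m) atTop (𝓝 (exp (Kᴴ + K))) := by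
      refine this.congr fun m => ?_
      rw [Function.comp_apply, hXc]
    exact (RCLike.continuous_re.tendsto _).comp ((continuous_id.matrix_trace.tendsto _).comp hmat)
  have := ge_of_tendsto hlim (Eventually.of_forall hineq)
  rwa [trace_mul_comm, add_comm] at this

/-- **Golden–Thompson from the Lie–Trotter formula** (via Petz's Theorem 5).
Petz, Banach Center Publ. 30 (1994) 287, §3 ("The simplest proof of the Golden–Thompson
inequality uses the following exponential product formula"). [cite: Petz1994, §3, eq. (8)] -/
theorem goldenThompson_of_lieTrotter (h : lieTrotter_productFormula (𝕜 := 𝕜) (n := n)) :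
    goldenThompson (𝕜 := 𝕜) (n := n) :=
  goldenThompson_of_petz (petz_of_lieTrotter h)

end Literature.MathematicalPhysics.QuantumLattice
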